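import Literature.AlgebraicGeometry.AbelianSchemes.LDeltaCubeOfLinearRigidification
import Literature.AlgebraicGeometry.AbelianSchemes.MumfordClassLetterOfPolarizationCube
import Literature.AlgebraicGeometry.AbelianSchemes.MFKSubfunctorOfHilbIntrinsic
import Literature.AlgebraicGeometry.Modules.SerreTwistOneOfFrameSectionsIso
import Literature.AlgebraicGeometry.Modules.PushforwardFrameOfIsIso
import Literature.AlgebraicGeometry.Modules.IsoOfFrames
import Literature.AlgebraicGeometry.Modules.SerreTwistModBaseChange
import Literature.AlgebraicGeometry.Modules.PullbackFlatMono
import Literature.AlgebraicGeometry.Modules.PushforwardBaseChangeOpenImmersion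
import Literature.AlgebraicGeometry.Modules.PullbackReflectsIsoOfFlatSurjective
import Literature.AlgebraicGeometry.Modules.StalkCriteria
import HarnessLib

/-!
# A linearly rigidified triple in intrinsic position satisfies INT(b) — the (H-rep) half of [MumfordFogartyKirwan1994] Prop. 7.3
# (converse of ★ R-A `isLinearRigidification_comp_of_clauses`; consumer: the representability field of ★ (8α) `SiegelFramedCovariant`)

Layer `Literature/AlgebraicGeometry/AbelianSchemes`, namespaces `Literature.AlgebraicGeometry.Modules` (§0) and
`Literature.AlgebraicGeometry.AbelianSchemes.PolarizedAbelianSchemeWithLevel` (§§1–2).  THEOREMS ONLY (no definition, no named fact, no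
instance, no notation, no `sorry`).  Cell `hodgecm-mathlib` (D-0151), F-DAG row F-6 (H-rep), hand R-B (B-plan1 (g17) 2026-08-30T10:56:54Z,
B-p18 (g19) split 10:55:54Z); author B-p17 (g14).  HC_CM is proved only modulo the 7 printed citations until rung 0 closes; nothing here
is about HC.

SETTING ([MumfordFogartyKirwan1994] Ch. 7 §2, proof of Prop. 7.3, read backwards).  A flat family `p₀ : Z₀ → H₀` with its embedding
`ι₀ : Z₀ → 𝐏ⁿ_ℤ` (`n + 1 = #J + 1 = 6^g·d`), sections `ε₀, τ₀`, the line bundle `L₀ := 𝒪_{Z₀}(1) = twistMod ι₀ 𝒪 1`, a reindexing `κ`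
and the coordinate frame `u₀ : 𝒪_{H₀}^{6^g·d} → (p₀)_*L₀` (letter `hu₀` of ★ R-A `SiegelUniversalTripleOfFlatFamily`: «`u₀(ε_k) = x_{κ k}`»).
A TEST OBJECT: a triple `P = (X/T, λ, σ)` (★ `PolarizedAbelianSchemeWithLevel`) over a locally Noetherian `T`, hat-normalised
(`hP : 𝒫|_{X × {ε_X̂}} ≅ 𝒪`, FINDING 8aea22b3 (R1)), sitting in a CARTESIAN SQUARE `prb : X → Z₀` over `b : T → H₀` with unit `ε₀|_T`
and sections `τ₀|_T`, and LINEARLY RIGIDIFIED by `prb ≫ ι₀` (★ (8α) `IsLinearRigidification`, [MumfordFogartyKirwan1994] Def. 7.5).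

* §0 (generic, `Modules`) **`isIso_of_forall_isIso_pullback_map_openCover`** — isomorphisms of `𝒪_T`-modules are Zariski-local on `T`
  (stalks: ★ `stalkFunctor_map_bijective_of_pullback`, ★ `isIso_of_stalkFunctor_map_bijective`);
  **`isIso_of_app_unitSectionLE_freeSectionOn_eq_basisSection`** — a morphism `Φ : k^*𝒪_S^{(ι)} → N` sending the pulled-back basis sections
  `η_k(ε_j)` to the basis sections of a global frame `e : 𝒪^{(ι)} ≅ N|_⊤` IS an isomorphism (`Φ|_⊤ = e₁⁻¹ ≫ e` for the pulled-back frame `e₁`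
  of ★ (s1)'s proof; ★ `homOfTop`).
* §1 (FRAME level) **`isIso_pullback_map_comp_pushforwardBaseChangeHom_of_frame`** — clause (VI) «`b^*u₀ ≫ β_b : b^*𝒪^{6^g·d} →
  π_*(prb^*L₀)` is an isomorphism» for a family `π : X → T` with a square `prb` onto `p₀`, from a global frame `e` of `π_*E` and an
  isomorphism `φ : E ≅ 𝒪_X(1) = twistMod (prb ≫ ι₀) 𝒪 1` matching basis sections with coordinate sections (the letter of ★
  `SerreTwist.exists_iso_twistMod_one_homEquiv_pointOfSections_app_eq`): both `b^*u₀ ≫ β_b` and the frame send `η_b(ε_k)` to `η_{prb}(x_{κ k})`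
  (`hu₀`, ★ `pushforwardBaseChangeHom_app_unitSectionLE`, ★ (γ1) `pullbackTwistHom_app_unitSectionLE_monomialSection`), so §0 applies.
* §2 **`mfkIntrinsic_of_isLinearRigidification`** — THE HEAD: `P` as above satisfies `INT(b)`, the conclusion of ★ FILE 3
  `mfkIntrinsic_of_existsUnique_comp` at `L₀ := twistMod ι₀ 𝒪 1`, VERBATIM.  Witnesses: `A_b := X`, `D_b := P.D`, `L_b := prb^*L₀`, `ω := λ`,
  `Γ₁ := (1, λ)`, the triple's own polarisation / type / level; clause (V) = ★ R-B2a
  `nonempty_normalised_iso_LDelta_tensorPow_of_isLinearRigidification`; clause (P) = ★ R-B1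
  `forall_nonempty_classify_pow_six_comp_of_nonempty_iso_tensorPow_three`; clause (VI) = §1 on every member of the rigidifying cover (★
  V-brick section clause, ★ T2-mod `isIso_pullback_map_comp_pushforwardBaseChangeHom_iff_of_isPullback_paste_horiz`, ★
  `isIso_pushforwardBaseChangeHom_of_isOpenImmersion`) glued by §0; the fibre clauses (I) from `X → T` smooth with geometrically connected
  fibres along the square's comparison isomorphism.

## References
* [MumfordFogartyKirwan1994] D. Mumford, J. Fogarty, F. Kirwan, *Geometric Invariant Theory*, 3rd ed. (1994), Ch. 7 §2 Prop. 7.3 and its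
  proof, steps (I)–(VI) (pp. 132–134), Def. 7.5 (p. 130), Prop. 7.6 (p. 136), Def. 7.2 (p. 129).
* [Hartshorne1977] R. Hartshorne, *Algebraic Geometry* (1977), II §5 (pp. 109–110), II Prop. 5.12 (c) (p. 117), II Thm. 7.1 (p. 150),
  II Prop. 1.1 (p. 63).
* [StacksProject] The Stacks Project, Tag 02KG, Tag 02N6.
-/

noncomputable section

-- Mathlib's `Over`/pull-back API and `Scheme.Modules` section API are stated across semireducible wrappers (as in ★ (R3), ★ R-A).
set_option backward.isDefEq.respectTransparency false

open CategoryTheory CategoryTheory.Limits AlgebraicGeometry MonoidalCategory Opposite TopologicalSpace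
open Literature.AlgebraicGeometry.Modules Literature.AlgebraicGeometry.Modules.SerreTwist
open Literature.AlgebraicGeometry.Motives Literature.AlgebraicGeometry.Motives.GeneratingSections
open Literature.AlgebraicGeometry.Morphisms Literature.AlgebraicGeometry.AbelianVarieties
open Literature.AlgebraicGeometry.ModuliOfAbelianVarieties Literature.AlgebraicGeometry.AbelianSchemes.AbelianSchemeOver
open scoped MonObj

universe u

/-! ## §0 Two generic facts: isomorphisms are Zariski-local on the base; a map from `k^*𝒪^{(ι)}` matching a frame is an isomorphism -/

namespace Literature.AlgebraicGeometry.Modules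

/-- **Isomorphisms of `𝒪_T`-modules are Zariski-local on `T`**: if `φ` pulls back to an isomorphism on every member of an open cover
of `T`, then `φ` is an isomorphism — every stalk map of `φ` is the stalk map at a point of some member (★ `stalkFunctor_map_bijective_of_pullback`,
open immersions are flat), and isomorphisms are detected on stalks (★ `isIso_of_stalkFunctor_map_bijective`, [Hartshorne1977] II Prop. 1.1).
[cite: Hartshorne1977, II Prop. 1.1 (p. 63)] -/
theorem isIso_of_forall_isIso_pullback_map_openCover {T : Scheme.{u}} {M N : T.Modules} (φ : M ⟶ N) (𝒰 : Scheme.OpenCover.{u} T)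
    (h : ∀ i, IsIso ((Scheme.Modules.pullback (𝒰.f i)).map φ)) : IsIso φ :=
  isIso_of_stalkFunctor_map_bijective φ fun t ↦ by
    obtain ⟨i, y, rfl⟩ := 𝒰.exists_eq t
    haveI := h i
    exact stalkFunctor_map_bijective_of_pullback (𝒰.f i) φ y

/-- Basis sections of a frame moved across an isomorphism of modules (restated from ★ (s1) `PushforwardFrameOfIsIso`, private there). [folklore] -/
private theorem basisSection_trans_overFunctor_mapIso' {X : Scheme.{u}} {E E' : X.Modules} {W : X.Opens} {I : Type u}
    (e : SheafOfModules.free I ≅ E.over W) (φ : E ≅ E') (i : I) :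
    basisSection (e ≪≫ (SheafOfModules.overFunctor _ W).mapIso φ) i = φ.hom.app W (basisSection e i) := by
  rw [basisSection, basisSection, Iso.trans_hom, SheafOfModules.freeHomEquiv_comp_apply,
    overSectionsEquiv_sectionsMap', Functor.mapIso_hom, appLE_over_map]

/-- An isomorphism over `⊤` gives an isomorphism of modules (`homOfTop` is functorial). [folklore] -/
private theorem isIso_homOfTop_of_isIso {X : Scheme.{u}} {M N : X.Modules} (ψ : M.over ⊤ ⟶ N.over ⊤) [IsIso ψ] : IsIso (homOfTop ψ) :=
  ⟨homOfTop (inv ψ), by rw [← homOfTop_comp, IsIso.hom_inv_id, homOfTop_id], by rw [← homOfTop_comp, IsIso.inv_hom_id, homOfTop_id]⟩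

/-- **A morphism `Φ : k^*𝒪_S^{(ι)} → N` sending the pulled-back basis sections `η_k(ε_j)|_⊤` to the basis sections of a global frame
`e : 𝒪^{(ι)} ≅ N|_⊤` is an isomorphism**: over `⊤`, `Φ|_⊤ = e₁⁻¹ ≫ e` for the pulled-back frame `e₁` of `k^*𝒪^{(ι)}` (★ `pullbackFrame`, ★
`basisSection_pullbackFrame`; two morphisms out of a free module agree when they agree on the basis, Mathlib `SheafOfModules.freeHomEquiv`),
and `Φ = homOfTop (Φ|_⊤)`. [cite: Hartshorne1977, II §5 (pp. 109–110)] -/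
theorem isIso_of_app_unitSectionLE_freeSectionOn_eq_basisSection {S S' : Scheme.{u}} {I : Type u} [Fintype I] (k : S' ⟶ S) {N : S'.Modules}
    (Φ : (Scheme.Modules.pullback k).obj (freeModule S I) ⟶ N) (e : SheafOfModules.free I ≅ N.over ⊤)
    (h : ∀ j, Φ.app ⊤ (unitSectionLE k (freeModule S I) (V := ⊤) (U := ⊤) le_top (freeSectionOn S j ⊤)) = basisSection e j) :
    IsIso Φ := by
  -- the pulled-back frame of `k^*𝒪^{(ι)}` over `k⁻¹⊤`, restricted to `⊤`
  let e₀ : SheafOfModules.free I ≅ ((Scheme.Modules.pullback k).obj (freeModule S I)).over (k ⁻¹ᵁ ⊤) :=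
    pullbackFrame k (freeModuleFrame S I ⊤)
  let e₁ : SheafOfModules.free I ≅ ((Scheme.Modules.pullback k).obj (freeModule S I)).over ⊤ :=
    SheafOfModules.restrictTrivialisation (R := S'.ringCatSheaf) (homOfLE (le_top : (⊤ : S'.Opens) ≤ k ⁻¹ᵁ ⊤)) e₀
  have h₁ : ∀ j, basisSection e₁ j = unitSectionLE k (freeModule S I) (V := ⊤) (U := ⊤) le_top (freeSectionOn S j ⊤) := fun j ↦ by
    show basisSection (SheafOfModules.restrictTrivialisation (R := S'.ringCatSheaf) (homOfLE _) e₀) j = _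
    rw [basisSection_restrictTrivialisation, show e₀ = pullbackFrame k (freeModuleFrame S I ⊤) from rfl,
      basisSection_pullbackFrame, basisSection_freeModuleFrame]
    rfl
  -- `Φ|_⊤ = e₁⁻¹ ≫ e`
  have key : (SheafOfModules.overFunctor _ ⊤).map Φ = e₁.inv ≫ e.hom := by
    rw [← cancel_epi e₁.hom, e₁.hom_inv_id_assoc]
    apply (N.over ⊤).freeHomEquiv.injective
    funext j
    apply (Scheme.Modules.overSectionsEquiv N ⊤).injective
    rw [SheafOfModules.freeHomEquiv_comp_apply, overSectionsEquiv_sectionsMap', appLE_over_map]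
    change Φ.app ⊤ (basisSection e₁ j) = basisSection e j
    rw [h₁, h j]
  haveI : IsIso ((SheafOfModules.overFunctor _ ⊤).map Φ) := by rw [key]; infer_instance
  rw [← homOfTop_overFunctor_map Φ]
  exact isIso_homOfTop_of_isIso _

end Literature.AlgebraicGeometry.Modules

/-! ## §1 Frame level: clause (VI) from a framed `π_*E` with `E ≅ 𝒪_X(1)` matching basis and coordinate sections -/

namespace Literature.AlgebraicGeometry.AbelianSchemes

namespace PolarizedAbelianSchemeWithLevel

variable {H₀ Z₀ : Scheme.{0}} (p₀ : Z₀ ⟶ H₀) {J : Type} (ι₀ : Z₀ ⟶ projectiveSpaceInt J)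
  {g N : ℕ} {δ : Fin g → ℕ} (κ : Fin (6 ^ g * polarizationDegree δ) ≃ Fin (Nat.card J + 1))
  (u₀ : freeModule H₀ (Fin (6 ^ g * polarizationDegree δ)) ⟶
    (Scheme.Modules.pushforward p₀).obj (twistMod ι₀ (unitModule Z₀) 1))
  (hu₀ : ∀ (k : Fin (6 ^ g * polarizationDegree δ)) (V : H₀.Opens), u₀.app V (freeSectionOn H₀ k V) =
    ((Scheme.Modules.pushforward p₀).obj (twistMod ι₀ (unitModule Z₀) 1)).presheaf.map (homOfLE (le_top : V ≤ ⊤)).op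
      (monomialSection ι₀ 1 fun _ => κ k))

/-- `freeMap f ≫ freeMap f' = 𝟙` for a retraction (as in ★ R-A, private there). [folklore] -/
private theorem freeMap_comp_freeMap_eq_id' {X : Scheme.{0}} {W : X.Opens} {I I' : Type} (f : I → I') (f' : I' → I)
    (h : ∀ i, f' (f i) = i) :
    SheafOfModules.freeMap (R := X.ringCatSheaf.over W) f ≫ SheafOfModules.freeMap f' = 𝟙 _ :=
  Cofan.IsColimit.hom_ext (SheafOfModules.isColimitFreeCofan I) _ _ fun i => by
    rw [SheafOfModules.freeCofan_inj, SheafOfModules.ιFree_freeMap_assoc, SheafOfModules.ιFree_freeMap, h]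
    exact (Category.comp_id _).symm

/-- A frame reindexed along an equivalence of index types (as in ★ R-A, private there). [folklore] -/
private theorem exists_frame_reindex' {X : Scheme.{0}} {E : X.Modules} {W : X.Opens} {I I' : Type} (κ : I ≃ I')
    (e : SheafOfModules.free I' ≅ E.over W) :
    ∃ e' : SheafOfModules.free I ≅ E.over W, ∀ i, basisSection e' i = basisSection e (κ i) := by
  refine ⟨⟨SheafOfModules.freeMap κ, SheafOfModules.freeMap κ.symm,
    freeMap_comp_freeMap_eq_id' _ _ κ.symm_apply_apply, freeMap_comp_freeMap_eq_id' _ _ κ.apply_symm_apply⟩ ≪≫ e,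
    fun i => ?_⟩
  rw [basisSection, basisSection, Iso.trans_hom, SheafOfModules.freeHomEquiv_comp_apply,
    SheafOfModules.freeHomEquiv_freeMap, SheafOfModules.freeHomEquiv_apply]
  rfl

include hu₀ in
/-- **Clause (VI) at the FRAME level** ([MumfordFogartyKirwan1994] Prop. 7.3 step (VI) «`H⁰(𝒪(1)) ⊗ 𝒪 ⥲ π_*𝒪(1)`», produced rather than
assumed): let `π : X → T` sit in a square `prb : X → Z₀` over `b : T → H₀` onto `p₀` (`w`), let `E` be a module on `X` with a GLOBAL
FRAME `e : 𝒪_T^{#J+1} ≅ π_*E`, and let `φ : E ≅ 𝒪_X(1) = twistMod (prb ≫ ι₀) 𝒪 1` send the `j`-th basis section of `e` to the `j`-th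
coordinate section — the letter of ★ `SerreTwist.exists_iso_twistMod_one_homEquiv_pointOfSections_app_eq` for a frame-rigidified triple.
Then **`b^*u₀ ≫ β_b : b^*𝒪_{H₀}^{6^g·d} → π_*(prb^*L₀)` is an isomorphism**: both it and the frame `κ^*e ≫ π_*(φ⁻¹ ≫ θ⁻¹)`
(`θ : prb^*L₀ ≅ 𝒪_X(1)`, ★ `isIso_pullbackTwistHom`) send the pulled-back basis section `η_b(ε_k)` to `η_{prb}(x_{κ k})` (`hu₀`, ★
`pushforwardBaseChangeHom_app_unitSectionLE`, ★ (γ1) `pullbackTwistHom_app_unitSectionLE_monomialSection`), so §0 applies.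
[cite: MumfordFogartyKirwan1994, Ch. 7 §2 Prop. 7.3, step (VI) of the proof (p. 134)] [cite: Hartshorne1977, II Prop. 5.12 (c) (p. 117)] -/
theorem isIso_pullback_map_comp_pushforwardBaseChangeHom_of_frame {T X : Scheme.{0}} (π : X ⟶ T) {b : T ⟶ H₀}
    (prb : X ⟶ Z₀) (w : prb ≫ p₀ = π ≫ b) {E : X.Modules}
    (e : SheafOfModules.free (Fin (Nat.card J + 1)) ≅ ((Scheme.Modules.pushforward π).obj E).over ⊤)
    (φ : E ≅ twistMod (prb ≫ ι₀) (unitModule X) 1)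
    (hφ : ∀ i, φ.hom.app ⊤ (basisSection e i :) = monomialSection (prb ≫ ι₀) 1 fun _ : Fin 1 => i) :
    IsIso ((Scheme.Modules.pullback b).map u₀ ≫ pushforwardBaseChangeHom w (twistMod ι₀ (unitModule Z₀) 1)) := by
  haveI := isIso_pullbackTwistHom prb ι₀ 1
  let θ : (Scheme.Modules.pullback prb).obj (twistMod ι₀ (unitModule Z₀) 1) ≅ twistMod (prb ≫ ι₀) (unitModule X) 1 :=
    asIso (pullbackTwistHom prb ι₀ 1)
  -- `ψ : E ≅ prb^*L₀` and its values on the basis sections of `e`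
  let ψ : E ≅ (Scheme.Modules.pullback prb).obj (twistMod ι₀ (unitModule Z₀) 1) := φ ≪≫ θ.symm
  have hψ : ∀ i, ψ.hom.app ⊤ (basisSection e i :) =
      unitSectionLE prb (twistMod ι₀ (unitModule Z₀) 1) (V := ⊤) (U := ⊤) le_top (monomialSection ι₀ 1 fun _ : Fin 1 => i) := by
    intro i
    have hθ := pullbackTwistHom_app_unitSectionLE_monomialSection prb ι₀ 1 fun _ : Fin 1 => i
    have hinv : θ.inv.app ⊤ (θ.hom.app ⊤ (unitSectionLE prb (twistMod ι₀ (unitModule Z₀) 1) (V := ⊤) (U := ⊤) le_top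
        (monomialSection ι₀ 1 fun _ : Fin 1 => i))) =
        unitSectionLE prb (twistMod ι₀ (unitModule Z₀) 1) (V := ⊤) (U := ⊤) le_top (monomialSection ι₀ 1 fun _ : Fin 1 => i) := by
      rw [← CategoryTheory.comp_apply, ← Scheme.Modules.Hom.comp_app, θ.hom_inv_id]
      rfl
    change (φ.hom ≫ θ.inv).app ⊤ _ = _
    rw [Scheme.Modules.Hom.comp_app, CategoryTheory.comp_apply, hφ i, ← hinv]
    exact congrArg (θ.inv.app ⊤) hθ.symm
  -- the frame of `π_*(prb^*L₀)` over `⊤`: reindex `e` along `κ`, then move across `π_*ψ`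
  obtain ⟨eκ, heκ⟩ := exists_frame_reindex' κ e
  let e' : SheafOfModules.free (Fin (6 ^ g * polarizationDegree δ)) ≅
      ((Scheme.Modules.pushforward π).obj ((Scheme.Modules.pullback prb).obj (twistMod ι₀ (unitModule Z₀) 1))).over ⊤ :=
    eκ ≪≫ (SheafOfModules.overFunctor _ ⊤).mapIso ((Scheme.Modules.pushforward π).mapIso ψ)
  refine isIso_of_app_unitSectionLE_freeSectionOn_eq_basisSection b _ e' fun k ↦ ?_
  -- both sides are `η_{prb}(x_{κ k})`
  rw [basisSection_trans_overFunctor_mapIso', Functor.mapIso_hom, Scheme.Modules.pushforward_map_app, heκ k]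
  change _ = ψ.hom.app ⊤ (basisSection e (κ k) :)
  rw [hψ (κ k), Scheme.Modules.Hom.comp_app, CategoryTheory.comp_apply, pullback_map_app_unitSectionLE]
  have hk : u₀.app ⊤ (freeSectionOn H₀ k ⊤) = monomialSection ι₀ 1 fun _ => κ k := by
    rw [hu₀ k ⊤]
    exact map_id_apply _ _
  rw [hk]
  exact pushforwardBaseChangeHom_app_unitSectionLE w (twistMod ι₀ (unitModule Z₀) 1) (V := ⊤) (W := ⊤) le_top
    (monomialSection ι₀ 1 fun _ => κ k)

/-! ## §2 HEAD: a linearly rigidified, hat-normalised triple in intrinsic position satisfies INT(b) -/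

/-- **Clause (P) for the test triple itself, as a named head** ((C2) export for ★ R-C's comparison brick): for a hat-normalised,
linearly rigidified `P` read through `prb ≫ ι₀` and its graph `Γ₁`, `[6] ≫ λ` CLASSIFIES `Λ(L_b′)` with `L_b′ := prb^*L₀ ⊗ π^*(ε^*prb^*L₀)^∨`
(★ R-B1 `forall_nonempty_classify_pow_six_comp_of_nonempty_iso_tensorPow_three` at the (V)-isomorphism of ★ R-B2a
`nonempty_normalised_iso_LDelta_tensorPow_of_isLinearRigidification`). [cite: MumfordFogartyKirwan1994, Ch. 7 §2 Proposition 7.3 (pp. 132–134)]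
[cite: MumfordFogartyKirwan1994, Ch. 6 §2 Proposition 6.10 (p. 121)] -/
theorem forall_nonempty_classify_pow_six_of_isLinearRigidification [Finite J] {T : Scheme.{0}} [IsLocallyNoetherian T]
    (P : PolarizedAbelianSchemeWithLevel g N δ T)
    (hP : Nonempty ((Scheme.Modules.pullback (DualPair.unitHatSlice P.D)).obj P.D.P ≅ SheafOfModules.unit _))
    (prb : P.A.X.left ⟶ Z₀) (hLR : P.IsLinearRigidification J (prb ≫ ι₀))
    (Γ₁ : P.A.X.left ⟶ P.A.prodLeft P.D.hat) (hΓ₁₁ : Γ₁ ≫ pullback.fst P.A.X.hom P.D.hat.X.hom = 𝟙 _)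
    (hΓ₁₂ : Γ₁ ≫ pullback.snd P.A.X.hom P.D.hat.X.hom = P.pol.lam.left) ⦃U : Over T⦄ (a : U ⟶ P.A.X) :
    Nonempty ((Scheme.Modules.pullback (P.A.X ◁ (a ≫ ((𝟙 P.A.X) ^ 6) ≫ P.pol.lam)).left).obj P.D.P ≅
      (Scheme.Modules.pullback (P.A.X ◁ a).left).obj (P.A.mumfordBundle
        (tensorObj ((Scheme.Modules.pullback prb).obj (twistMod ι₀ (unitModule Z₀) 1)) ((Scheme.Modules.pullback P.A.X.hom).obj
          (Modules.dual ((Scheme.Modules.pullback P.A.unitSection).obj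
            ((Scheme.Modules.pullback prb).obj (twistMod ι₀ (unitModule Z₀) 1)))))))) :=
  P.A.forall_nonempty_classify_pow_six_comp_of_nonempty_iso_tensorPow_three P.D hP P.pol Γ₁ hΓ₁₁ hΓ₁₂
    (P.A.hasRank_normalised _ (hasRank_pullback prb (hasRank_twistMod_unitModule ι₀ 1)))
    (P.nonempty_normalised_iso_LDelta_tensorPow_of_isLinearRigidification J ι₀ hLR prb rfl Γ₁ hΓ₁₁ hΓ₁₂) a

include hu₀ in
/-- **[MumfordFogartyKirwan1994] Prop. 7.3, the representability half: a LINEARLY RIGIDIFIED triple in intrinsic position satisfies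
`INT(b)`.**  Let `p₀ : Z₀ → H₀` be the raw family with embedding `ι₀ : Z₀ → 𝐏ⁿ_ℤ`, sections `ε₀, τ₀`, `L₀ := 𝒪_{Z₀}(1)` and coordinate
frame `u₀` (letter `hu₀`).  Let `P = (X/T, λ, σ)` be a polarised abelian scheme with level structure over a locally Noetherian `T`,
hat-normalised (`hP : 𝒫|_{X × {ε_X̂}} ≅ 𝒪`), with a cartesian square `prb : X → Z₀` over `b : T → H₀` onto `p₀` under which the unit is
`ε₀|_T` and the level sections are the `τ₀ i|_T`, and suppose `prb ≫ ι₀ : X → 𝐏ⁿ_ℤ` is a ★ (8α) linear rigidification of `P`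
([MumfordFogartyKirwan1994] Def. 7.5).  Then `INT(b)` holds — the conclusion of ★ FILE 3 `mfkIntrinsic_of_existsUnique_comp` at
`L₀ := twistMod ι₀ 𝒪 1`, VERBATIM (the right-hand side of ★ R-A `exists_siegelUniversalTriple_iff_mfkIntrinsic`): the fibres of
`Z₀ ×_{H₀} T → T` are smooth and geometrically connected (they are those of `X → T`, along the square's comparison isomorphism), and
`A_b := X` with `prb`, its unit and sections, `D_b := (X̂, 𝒫)`, `L_b := prb^*L₀`, `ω := λ`, `Γ₁ := (1, λ)` satisfy: (P) «`[6]λ` classifies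
`Λ(L_b′)`» (★ R-B1 `forall_nonempty_classify_pow_six_comp_of_nonempty_iso_tensorPow_three`), (V) «`L_b′ ≅ L^Δ(λ)^{⊗3}`» (★ R-B2a
`nonempty_normalised_iso_LDelta_tensorPow_of_isLinearRigidification`), (III)(IV)(V′) by the triple's own polarisation / type / level, and
(VI) «`b^*u₀ ≫ β_b` is an isomorphism» — on each member `uᵢ` of the rigidifying cover the frame of `π_*L^Δ(λ|_{Uᵢ})³` IS `𝒪(1)` with its
coordinate sections (★ `SerreTwist.exists_iso_twistMod_one_homEquiv_pointOfSections_app_eq`, [Hartshorne1977] II Thm. 7.1 (a)), so §1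
gives (VI) along `uᵢ ≫ b`, which is (VI) along `b` pulled back to `Uᵢ` (★ `isIso_pullback_map_comp_pushforwardBaseChangeHom_iff_of_isPullback_paste_horiz`,
★ `isIso_pushforwardBaseChangeHom_of_isOpenImmersion`), and isomorphisms are Zariski-local on `T` (§0).
[cite: MumfordFogartyKirwan1994, Ch. 7 §2 Proposition 7.3 (pp. 132–134)] [cite: MumfordFogartyKirwan1994, Ch. 7 §2 Def. 7.5 (p. 130) and Prop. 7.6 (p. 136)]
[cite: Hartshorne1977, II Thm. 7.1 (a) (p. 150)] -/
theorem mfkIntrinsic_of_isLinearRigidification [Finite J] (ε₀ : H₀ ⟶ Z₀) (τ₀ : Fin g ⊕ Fin g → (H₀ ⟶ Z₀))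
    {T : Scheme.{0}} [IsLocallyNoetherian T] (P : PolarizedAbelianSchemeWithLevel g N δ T)
    (hP : Nonempty ((Scheme.Modules.pullback (DualPair.unitHatSlice P.D)).obj P.D.P ≅ SheafOfModules.unit _))
    (b : T ⟶ H₀) (prb : P.A.X.left ⟶ Z₀) (sqb : IsPullback prb P.A.X.hom p₀ b)
    (hLR : P.IsLinearRigidification J (prb ≫ ι₀))
    (hunit : P.A.unitSection ≫ prb = b ≫ ε₀) (hσ : ∀ i, (P.level.σ i).left ≫ prb = b ≫ τ₀ i) :
    Smooth (pullback.snd p₀ b) ∧ GeometricallyConnected (pullback.snd p₀ b) ∧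
      ∃ (Ab : AbelianSchemeOver T) (prb' : Ab.X.left ⟶ Z₀) (sqb' : IsPullback prb' Ab.X.hom p₀ b)
        (_ : Ab.IsOfRelDim g) (_ : Ab.unitSection ≫ prb' = b ≫ ε₀)
        (σb : Fin g ⊕ Fin g → Ab.Sections) (_ : ∀ i, (σb i).left ≫ prb' = b ≫ τ₀ i)
        (Db : Ab.DualPair)
        (_ : Nonempty ((Scheme.Modules.pullback (DualPair.unitHatSlice Db)).obj Db.P ≅ SheafOfModules.unit _))
        (Lb : Ab.left.Modules) (_ : Nonempty (Lb ≅ (Scheme.Modules.pullback prb').obj (twistMod ι₀ (unitModule Z₀) 1)))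
        (ω : Ab.X ⟶ Db.hat.X) (Γ₁ : Ab.left ⟶ Ab.prodLeft Db.hat),
        IsMonHom ω ∧
          (∀ ⦃U : Over T⦄ (a : U ⟶ Ab.X),
            Nonempty ((Scheme.Modules.pullback (Ab.X ◁ (a ≫ ((𝟙 Ab.X) ^ 6) ≫ ω)).left).obj Db.P ≅
              (Scheme.Modules.pullback (Ab.X ◁ a).left).obj (Ab.mumfordBundle
                (tensorObj Lb ((Scheme.Modules.pullback Ab.X.hom).obj
                  (Modules.dual ((Scheme.Modules.pullback Ab.unitSection).obj Lb))))))) ∧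
          Γ₁ ≫ pullback.fst Ab.X.hom Db.hat.X.hom = 𝟙 _ ∧
          Γ₁ ≫ pullback.snd Ab.X.hom Db.hat.X.hom = ω.left ∧
          Nonempty (tensorObj Lb ((Scheme.Modules.pullback Ab.X.hom).obj
              (Modules.dual ((Scheme.Modules.pullback Ab.unitSection).obj Lb))) ≅
            tensorPow ((Scheme.Modules.pullback Γ₁).obj Db.P) 3) ∧
          ∃ pol : Ab.Polarization Db, pol.lam = ω ∧ pol.HasType δ ∧
            (∃ φ : LevelStructure g N Ab, (∀ i, φ.σ i = σb i) ∧ φ.IsSymplecticLiftable pol δ) ∧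
            IsIso ((Scheme.Modules.pullback b).map u₀ ≫
              pushforwardBaseChangeHom sqb'.w (twistMod ι₀ (unitModule Z₀) 1)) := by
  haveI := P.pol.isMonHom
  obtain ⟨𝒰, h𝒰⟩ := id hLR
  have hL₀ : HasRank (twistMod ι₀ (unitModule Z₀) 1) 1 := hasRank_twistMod_unitModule ι₀ 1
  have hLb : HasRank ((Scheme.Modules.pullback prb).obj (twistMod ι₀ (unitModule Z₀) 1)) 1 := hasRank_pullback prb hL₀
  -- the graph `Γ₁ = (1, λ)` of the polarisation
  let Γ₁ : P.A.X.left ⟶ P.A.prodLeft P.D.hat :=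
    pullback.lift (𝟙 _) P.pol.lam.left (by rw [Category.id_comp]; exact (Over.w P.pol.lam).symm)
  have hΓ₁₁ : Γ₁ ≫ pullback.fst P.A.X.hom P.D.hat.X.hom = 𝟙 _ := pullback.lift_fst _ _ _
  have hΓ₁₂ : Γ₁ ≫ pullback.snd P.A.X.hom P.D.hat.X.hom = P.pol.lam.left := pullback.lift_snd _ _ _
  -- (V): ★ R-B2a
  have hV := P.nonempty_normalised_iso_LDelta_tensorPow_of_isLinearRigidification J ι₀ hLR prb rfl Γ₁ hΓ₁₁ hΓ₁₂
  -- (P): ★ R-B1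
  have hPl := forall_nonempty_classify_pow_six_of_isLinearRigidification ι₀ P hP prb hLR Γ₁ hΓ₁₁ hΓ₁₂
  -- (VI): frame level on every member of the rigidifying cover (§1), then §0
  have hVI : IsIso ((Scheme.Modules.pullback b).map u₀ ≫ pushforwardBaseChangeHom sqb.w (twistMod ι₀ (unitModule Z₀) 1)) := by
    refine isIso_of_forall_isIso_pullback_map_openCover _ 𝒰 fun i ↦ ?_
    have sqi : IsPullback (pullback.fst P.A.X.hom (𝒰.f i)) (P.baseChange (𝒰.f i)).A.X.hom P.A.X.hom (𝒰.f i) :=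
      IsPullback.of_hasPullback _ _
    obtain ⟨Gr, hGr₁, hGr₂, F, h1, e, hcov, hEq⟩ := h𝒰 i
    -- the framed `L^Δ(λ|_{Uᵢ})³` IS `𝒪(1)` for `pr_X ≫ prb ≫ ι₀`, with its coordinate sections (★ V-brick section clause)
    have key : ∀ (m : (P.baseChange (𝒰.f i)).A.X.left ⟶ projectiveSpaceInt J),
        projectiveSpace.homEquiv (Over.mk (P.baseChange (𝒰.f i)).A.X.hom)
          (projectiveSpace.pointOfSections (Over.mk (P.baseChange (𝒰.f i)).A.X.hom)
            (ofCocycleSections F.U (CocycleSections.ofFrameSystem F h1 fun j ↦ (basisSection e j :)) hcov)) = m →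
        ∃ φ : tensorPow ((Scheme.Modules.pullback Gr).obj (P.baseChange (𝒰.f i)).D.P) 3 ≅
            twistMod m (unitModule (P.baseChange (𝒰.f i)).A.X.left) 1,
          ∀ j, φ.hom.app ⊤ (basisSection e j :) = monomialSection m 1 fun _ : Fin 1 => j := by
      rintro m rfl
      exact SerreTwist.exists_iso_twistMod_one_homEquiv_pointOfSections_app_eq (J := J) _ F h1
        (fun j ↦ (basisSection e j :)) hcov
    obtain ⟨φ, hφ⟩ := key ((pullback.fst P.A.X.hom (𝒰.f i) ≫ prb) ≫ ι₀) (by rw [hEq, Category.assoc])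
    have h6 := isIso_pullback_map_comp_pushforwardBaseChangeHom_of_frame p₀ ι₀ κ u₀ hu₀ (P.baseChange (𝒰.f i)).A.X.hom
      (pullback.fst P.A.X.hom (𝒰.f i) ≫ prb) (sqi.paste_horiz sqb).w e φ hφ
    rw [← isIso_pullback_map_comp_pushforwardBaseChangeHom_iff_of_isPullback_paste_horiz sqb sqi
      (twistMod ι₀ (unitModule Z₀) 1) u₀] at h6
    haveI := isIso_pushforwardBaseChangeHom_of_isOpenImmersion sqi
      ((Scheme.Modules.pullback prb).obj (twistMod ι₀ (unitModule Z₀) 1))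
    exact IsIso.of_isIso_comp_right _
      (pushforwardBaseChangeHom sqi.w ((Scheme.Modules.pullback prb).obj (twistMod ι₀ (unitModule Z₀) 1)))
  -- (I): the fibres of `Z₀ ×_{H₀} T → T` are those of `X → T`
  have hcmp : pullback.snd p₀ b = sqb.isoPullback.inv ≫ P.A.X.hom := sqb.isoPullback_inv_snd.symm
  have hsm : Smooth (pullback.snd p₀ b) := by
    rw [hcmp]
    exact MorphismProperty.RespectsIso.precomp @Smooth _ _ P.A.isSmooth
  have hgc : GeometricallyConnected (pullback.snd p₀ b) := by
    rw [hcmp]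
    exact MorphismProperty.RespectsIso.precomp @GeometricallyConnected _ _ P.A.geometricallyConnected
  exact ⟨hsm, hgc, P.A, prb, sqb, P.relDim, hunit, P.level.σ, hσ, P.D, hP, _, ⟨Iso.refl _⟩, P.pol.lam, Γ₁, P.pol.isMonHom, hPl,
    hΓ₁₁, hΓ₁₂, hV, P.pol, rfl, P.hasType, ⟨P.level, fun _ ↦ rfl, P.symplectic⟩, hVI⟩

end PolarizedAbelianSchemeWithLevel

end Literature.AlgebraicGeometry.AbelianSchemes

end
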